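import Mathlib
import Summits.Ventures.PercRepro2.HCov
import Summits.Ventures.PercRepro2.BHKAvoid
import Summits.Ventures.PercRepro2.ExploreA3
import Summits.Ventures.PercRepro2.RootLeafUSigns
import Summits.Ventures.PercRepro2.RootLeafUHalf
import Summits.Ventures.PercRepro2.RootLeafUCore

/-!
# (G4-u): the `b ∈ K` half `(YA)` of the `o ∈ L` second coefficient is non-negative
(blind cell PercRepro2, p4 g6; proofs/P4-G6-OU.md §3b, §5)

The `o ∈ L` half splits EXACTLY by the side of `b` into the `o`-localisations of the two halves
of the o-free core `(OU)` (RootLeafUOu): `T2oL/2 = (YA) + (YB)` (`T2oL_eq_YA_add_YB`), with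
`Y = P(Q, oL, c ∉ L)`, `Y_N = P(PD, oL)`, `Y_{bK} = P(Q, oL, c ∉ L, b ∈ K)`:

  `(YA) := hb·D·Y + d0·P(Q,bK)·Y + hb·t′·Y_N − (d0·Z + D)·Y_{bK} − Y_N·P(T′, bK)`,
  `(YB) := (d0·Z + D)·P(T, oL, bL) + Y_N·P(Q, bL, c ∉ K) − d0·P(Q, bL)·Y`.

**`YA_nonneg`**: `0 ≤ (YA)` — the exact four-product identity (`YA_mul_W_eq`)
  `W·(YA) = (D − d0·W)·W·(hb·Y − Y_{bK}) + W·(Y_N − d0·Y)·(hb·t′ − P(T′,bK))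
           + d0·(W + Z)·(Y·P(R,bK) − W·Y_{bK}) + d0·Z·Y·(W·hb − P(R,bK))`
with every factor non-negative: `Y_{bK} ≤ hb·Y` and `P(T, oL) ≤ (1−d0)·Y` (the tower bounds with the
`L`-event `o ∈ L`), `d0·W ≤ D` and `P(R,bK) ≤ W·hb` (Harris), `P(T′,bK) ≤ hb·t′` (`prob_Tp_bK_le`),
and `W·Y_{bK} ≤ Y·P(R,bK)` (BHK06 Thm 1.4 with the avoided set `{a₂, c}`).  So the sign
`0 ≤ T2oL` of (G4-u) is reduced to `0 ≤ (YB)` (census 800 / 800; the mixed mass `P(T, oL, bL)`).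
-/

namespace Summit.Ventures.PercRepro2

open UnionCluster CovForm

namespace RootLeafU

variable {V : Type*} {E : Type*} [Fintype E] [DecidableEq E] [Fintype V] [DecidableEq V]
  {R : Type*} [Field R] [LinearOrder R] [IsStrictOrderedRing R]

section YA

variable (p : E → R) (ends : E → Sym2 V) (o a₂ c b u : V)

/-- **The tower bound with the `L`-event `o ∈ L` and the `K`-event `b ∈ K`**:
`P(R, oL, bK) ≤ hb · P(R, oL)`. -/
lemma prob_R_oL_bK_le (hp : IsProbVec p) :
    prob p (avoidAll ends u {a₂, c} ∩ (connEvent ends u o ∩ connEvent ends a₂ b)) ≤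
      prob p (connEvent ends a₂ b) * prob p (avoidAll ends u {a₂, c} ∩ connEvent ends u o) := by
  classical
  have ha2 : a₂ ∈ ({a₂, c} : Finset V) := by simp
  have tB := prob_clusterIn_inter_avoid_eq_expect p ends u a₂ ha2 {W | o ∈ W} {W | b ∈ W}
  have t1 := prob_clusterIn_inter_avoid_eq_expect p ends u a₂ ha2 {W | o ∈ W} Set.univ
  have hg1 : ∀ K, delClusterProb p ends a₂ Set.univ K = 1 := delClusterProb_univ p ends a₂
  simp only [clusterInEvent_univ, Set.inter_univ, hg1, mul_one] at t1
  rw [ExploreA3.clusterInEvent_mem_eq, ExploreA3.clusterInEvent_mem_eq] at tB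
  rw [ExploreA3.clusterInEvent_mem_eq] at t1
  have e1 : connEvent ends u o ∩ connEvent ends a₂ b ∩ avoidAll ends u {a₂, c} =
      avoidAll ends u {a₂, c} ∩ (connEvent ends u o ∩ connEvent ends a₂ b) := Set.inter_comm _ _
  have e2 : connEvent ends u o ∩ avoidAll ends u {a₂, c} =
      avoidAll ends u {a₂, c} ∩ connEvent ends u o := Set.inter_comm _ _
  rw [e1] at tB
  rw [e2] at t1
  rw [tB, t1, ← expect_const_mul]
  refine expect_mono hp fun ω => ?_
  have h1 : delClusterProb p ends a₂ {W | b ∈ W} (cluster ends ω u) ≤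
      prob p (connEvent ends a₂ b) := delClusterProb_mem_le p ends hp a₂ b _
  have h2 : (0 : R) ≤ ({W : Set V | o ∈ W}).indicator 1 (cluster ends ω u) :=
    Set.indicator_apply_nonneg fun _ => zero_le_one
  have h3 : (0 : R) ≤ (avoidAll ends u {a₂, c}).indicator 1 ω :=
    Set.indicator_apply_nonneg fun _ => zero_le_one
  calc ({W : Set V | o ∈ W}).indicator 1 (cluster ends ω u) *
        delClusterProb p ends a₂ {W | b ∈ W} (cluster ends ω u) * (avoidAll ends u {a₂, c}).indicator 1 ω
      ≤ ({W : Set V | o ∈ W}).indicator 1 (cluster ends ω u) * prob p (connEvent ends a₂ b) *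
        (avoidAll ends u {a₂, c}).indicator 1 ω :=
        mul_le_mul_of_nonneg_right (mul_le_mul_of_nonneg_left h1 h2) h3
    _ = prob p (connEvent ends a₂ b) * (({W : Set V | o ∈ W}).indicator 1 (cluster ends ω u) *
        (avoidAll ends u {a₂, c}).indicator 1 ω) := by ring

/-- **The tower bound with the `L`-event `o ∈ L` and the `K`-event `c ∈ K`**:
`P(T, oL) ≤ P(a₂ ↔ c) · P(R, oL)`. -/
lemma prob_T_oL_le (hp : IsProbVec p) :
    prob p (TEvent ends u a₂ c ∩ connEvent ends u o) ≤
      prob p (connEvent ends a₂ c) * prob p (avoidAll ends u {a₂, c} ∩ connEvent ends u o) := by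
  have h := prob_T_bL_le p ends a₂ c o u hp
  exact h

omit [Fintype V] in
/-- **The exact split of the `o ∈ L` half by the side of `b`**: `T2oL/2 = (YA) + (YB)`
(a linear identity in the pattern masses after the splits `Q = PD ⊔ T ⊔ T′`, `R = PD ⊔ T`). -/
theorem T2oL_eq_YA_add_YB :
    T2oL p ends o a₂ c b u =
      2 * ((prob p (connEvent ends a₂ b) * prob p (PDEvent ends u a₂ c) *
              (prob p (PDEvent ends u a₂ c ∩ connEvent ends u o) +
                prob p (TEvent ends u a₂ c ∩ connEvent ends u o)) +
            prob p (avoidAll ends a₂ {c}) * prob p (avoidAll ends a₂ {u} ∩ connEvent ends a₂ b) *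
              (prob p (PDEvent ends u a₂ c ∩ connEvent ends u o) +
                prob p (TEvent ends u a₂ c ∩ connEvent ends u o)) +
            prob p (connEvent ends a₂ b) * prob p (TEvent ends a₂ u c) *
              prob p (PDEvent ends u a₂ c ∩ connEvent ends u o) -
            (prob p (avoidAll ends a₂ {c}) * prob p (avoidAll ends a₂ {u}) + prob p (PDEvent ends u a₂ c)) *
              (prob p (PDEvent ends u a₂ c ∩ (connEvent ends u o ∩ connEvent ends a₂ b)) +
                prob p (TEvent ends u a₂ c ∩ (connEvent ends u o ∩ connEvent ends a₂ b))) -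
            prob p (PDEvent ends u a₂ c ∩ connEvent ends u o) *
              prob p (TEvent ends a₂ u c ∩ connEvent ends a₂ b)) +
          ((prob p (avoidAll ends a₂ {c}) * prob p (avoidAll ends a₂ {u}) + prob p (PDEvent ends u a₂ c)) *
              prob p (TEvent ends u a₂ c ∩ (connEvent ends u o ∩ connEvent ends u b)) +
            prob p (PDEvent ends u a₂ c ∩ connEvent ends u o) *
              (prob p (PDEvent ends u a₂ c ∩ connEvent ends u b) +
                prob p (TEvent ends a₂ u c ∩ connEvent ends u b)) -
            prob p (avoidAll ends a₂ {c}) * prob p (avoidAll ends a₂ {u} ∩ connEvent ends u b) *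
              (prob p (PDEvent ends u a₂ c ∩ connEvent ends u o) +
                prob p (TEvent ends u a₂ c ∩ connEvent ends u o)))) := by
  have hZ := Qsplit_univ p ends u a₂ c
  have hbK := Qsplit p ends u a₂ c (connEvent ends a₂ b)
  have hbL := Qsplit p ends u a₂ c (connEvent ends u b)
  have hgap := gap_eq_Q p ends u a₂ b
  unfold T2oL EQb3 PDb EQ3
  rw [prob_univ, hgap, hZ, hbK, hbL]
  ring

/-- **`(YA) ≥ 0`**: the `b ∈ K` half of the `o ∈ L` second coefficient — the four-product identity
`YA_mul_W_eq` with non-negative factors. -/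
theorem YA_nonneg (hp : IsProbVec p) :
    0 ≤ prob p (connEvent ends a₂ b) * prob p (PDEvent ends u a₂ c) *
          (prob p (PDEvent ends u a₂ c ∩ connEvent ends u o) +
            prob p (TEvent ends u a₂ c ∩ connEvent ends u o)) +
        prob p (avoidAll ends a₂ {c}) * prob p (avoidAll ends a₂ {u} ∩ connEvent ends a₂ b) *
          (prob p (PDEvent ends u a₂ c ∩ connEvent ends u o) +
            prob p (TEvent ends u a₂ c ∩ connEvent ends u o)) +
        prob p (connEvent ends a₂ b) * prob p (TEvent ends a₂ u c) *
          prob p (PDEvent ends u a₂ c ∩ connEvent ends u o) -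
        (prob p (avoidAll ends a₂ {c}) * prob p (avoidAll ends a₂ {u}) + prob p (PDEvent ends u a₂ c)) *
          (prob p (PDEvent ends u a₂ c ∩ (connEvent ends u o ∩ connEvent ends a₂ b)) +
            prob p (TEvent ends u a₂ c ∩ (connEvent ends u o ∩ connEvent ends a₂ b))) -
        prob p (PDEvent ends u a₂ c ∩ connEvent ends u o) *
          prob p (TEvent ends a₂ u c ∩ connEvent ends a₂ b) := by
  classical
  -- splits
  have hZ := Qsplit_univ p ends u a₂ c
  have hbK := Qsplit p ends u a₂ c (connEvent ends a₂ b)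
  have hR : prob p (PDEvent ends u a₂ c) + prob p (TEvent ends u a₂ c) =
      prob p (avoidAll ends u {a₂, c}) := by
    have h := ISplit.prob_PD_add_T p ends u a₂ c Set.univ
    simpa only [Set.inter_univ] using h
  have hRbK := ISplit.prob_PD_add_T p ends u a₂ c (connEvent ends a₂ b)
  have hY := ISplit.prob_PD_add_T p ends u a₂ c (connEvent ends u o)
  have hYbK := ISplit.prob_PD_add_T p ends u a₂ c (connEvent ends u o ∩ connEvent ends a₂ b)
  have hd0 : prob p (avoidAll ends a₂ {c}) = 1 - prob p (connEvent ends a₂ c) := by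
    rw [avoidAll_singleton_eq, prob_compl]
  -- the six facts
  have hRl : IsLowerSet (avoidAll ends u {a₂, c}) := isLowerSet_avoidAll' ends u {a₂, c}
  have hcl : IsLowerSet (avoidAll ends a₂ {c}) := isLowerSet_avoidAll' ends a₂ {c}
  have f1 := prob_R_oL_bK_le p ends o a₂ c b u hp
  have f2 := prob_mul_prob_le_prob_inter_of_isLowerSet hp hcl hRl
  have hPD : prob p (avoidAll ends a₂ {c} ∩ avoidAll ends u {a₂, c}) =
      prob p (PDEvent ends u a₂ c) := by
    have h := prob_inter_add_prob_inter_compl p (avoidAll ends u {a₂, c}) (connEvent ends a₂ c)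
    have e1 : avoidAll ends u {a₂, c} ∩ connEvent ends a₂ c = TEvent ends u a₂ c := by
      rw [Set.inter_comm, conn_inter_R]
    have e2 : avoidAll ends a₂ {c} ∩ avoidAll ends u {a₂, c} =
        avoidAll ends u {a₂, c} ∩ (connEvent ends a₂ c)ᶜ := by
      rw [avoidAll_singleton_eq, Set.inter_comm]
    rw [e1] at h
    rw [e2]
    linarith
  have f3 := prob_Tp_bK_le p ends a₂ c b u hp
  have f4 := prob_T_oL_le p ends o a₂ c u hp
  have hU : IsUpperSet ({W : Set V | o ∈ W}) := fun _ _ h ho => h ho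
  have hV : IsUpperSet ({W : Set V | b ∈ W}) := fun _ _ h hb => h hb
  have ha2 : a₂ ∈ ({a₂, c} : Finset V) := by simp
  have f5 := bhk_cross_cluster_avoid p hp ends u a₂ ha2 hU hV
  rw [ExploreA3.clusterInEvent_mem_eq, ExploreA3.clusterInEvent_mem_eq] at f5
  have e5a : connEvent ends u o ∩ connEvent ends a₂ b ∩ avoidAll ends u {a₂, c} =
      avoidAll ends u {a₂, c} ∩ (connEvent ends u o ∩ connEvent ends a₂ b) := Set.inter_comm _ _
  have e5b : connEvent ends u o ∩ avoidAll ends u {a₂, c} =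
      avoidAll ends u {a₂, c} ∩ connEvent ends u o := Set.inter_comm _ _
  have e5c : connEvent ends a₂ b ∩ avoidAll ends u {a₂, c} =
      avoidAll ends u {a₂, c} ∩ connEvent ends a₂ b := Set.inter_comm _ _
  rw [e5a, e5b, e5c] at f5
  have f6 := prob_inter_le_prob_mul_prob_of_isLowerSet hp hRl (isUpperSet_connEvent ends a₂ b)
  -- non-negativity of the masses
  have nW := prob_nonneg hp (avoidAll ends u {a₂, c})
  have nY := prob_nonneg hp (avoidAll ends u {a₂, c} ∩ connEvent ends u o)
  have nZ := prob_nonneg hp (avoidAll ends a₂ {u})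
  have nd0 := prob_nonneg hp (avoidAll ends a₂ {c})
  have nhb := prob_nonneg hp (connEvent ends a₂ b)
  have nYbK := prob_nonneg hp (avoidAll ends u {a₂, c} ∩ (connEvent ends u o ∩ connEvent ends a₂ b))
  have nYN := prob_nonneg hp (PDEvent ends u a₂ c ∩ connEvent ends u o)
  -- the four non-negative products of `W·(YA)`
  have g1 : 0 ≤ (prob p (PDEvent ends u a₂ c) -
      prob p (avoidAll ends a₂ {c}) * prob p (avoidAll ends u {a₂, c})) *
      prob p (avoidAll ends u {a₂, c}) *
      (prob p (connEvent ends a₂ b) * prob p (avoidAll ends u {a₂, c} ∩ connEvent ends u o) -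
        prob p (avoidAll ends u {a₂, c} ∩ (connEvent ends u o ∩ connEvent ends a₂ b))) :=
    mul_nonneg (mul_nonneg (by linarith) nW) (by linarith)
  have g2 : 0 ≤ prob p (avoidAll ends u {a₂, c}) *
      (prob p (PDEvent ends u a₂ c ∩ connEvent ends u o) -
        prob p (avoidAll ends a₂ {c}) * prob p (avoidAll ends u {a₂, c} ∩ connEvent ends u o)) *
      (prob p (connEvent ends a₂ b) * prob p (TEvent ends a₂ u c) -
        prob p (TEvent ends a₂ u c ∩ connEvent ends a₂ b)) := by
    refine mul_nonneg (mul_nonneg nW ?_) (by linarith)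
    rw [hd0]
    linarith
  have g3 : 0 ≤ prob p (avoidAll ends a₂ {c}) *
      (prob p (avoidAll ends u {a₂, c}) + prob p (avoidAll ends a₂ {u})) *
      (prob p (avoidAll ends u {a₂, c} ∩ connEvent ends u o) *
          prob p (avoidAll ends u {a₂, c} ∩ connEvent ends a₂ b) -
        prob p (avoidAll ends u {a₂, c}) *
          prob p (avoidAll ends u {a₂, c} ∩ (connEvent ends u o ∩ connEvent ends a₂ b))) :=
    mul_nonneg (mul_nonneg nd0 (by linarith)) (by linarith)
  have g4 : 0 ≤ prob p (avoidAll ends a₂ {c}) * prob p (avoidAll ends a₂ {u}) *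
      prob p (avoidAll ends u {a₂, c} ∩ connEvent ends u o) *
      (prob p (avoidAll ends u {a₂, c}) * prob p (connEvent ends a₂ b) -
        prob p (avoidAll ends u {a₂, c} ∩ connEvent ends a₂ b)) :=
    mul_nonneg (mul_nonneg (mul_nonneg nd0 nZ) nY) (by linarith)
  -- `W · (YA) = g1 + g2 + g3 + g4` as polynomials in the atoms
  rw [← hR, ← hY, ← hYbK] at g1
  rw [← hR, ← hY] at g2
  rw [← hR, ← hRbK, ← hY, ← hYbK, hZ] at g3
  rw [← hR, ← hRbK, ← hY, hZ] at g4
  rw [← hR] at nW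
  rw [hZ, hbK]
  rcases eq_or_lt_of_le nW with hW0 | hWpos
  · -- `W = 0`: the masses of `R ∩ {o ∈ L}` vanish
    have hsum1 : prob p (PDEvent ends u a₂ c ∩ connEvent ends u o) +
        prob p (TEvent ends u a₂ c ∩ connEvent ends u o) = 0 := by
      have := prob_mono hp (Set.inter_subset_left :
        avoidAll ends u {a₂, c} ∩ connEvent ends u o ⊆ avoidAll ends u {a₂, c})
      rw [← hY, ← hR] at this
      linarith
    have hsum2 : prob p (PDEvent ends u a₂ c ∩ (connEvent ends u o ∩ connEvent ends a₂ b)) +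
        prob p (TEvent ends u a₂ c ∩ (connEvent ends u o ∩ connEvent ends a₂ b)) = 0 := by
      have := prob_mono hp (Set.inter_subset_left :
        avoidAll ends u {a₂, c} ∩ (connEvent ends u o ∩ connEvent ends a₂ b) ⊆ avoidAll ends u {a₂, c})
      rw [← hYbK, ← hR] at this
      linarith
    have n1 := prob_nonneg hp (PDEvent ends u a₂ c ∩ connEvent ends u o)
    have n2 := prob_nonneg hp (TEvent ends u a₂ c ∩ connEvent ends u o)
    have h1 : prob p (PDEvent ends u a₂ c ∩ connEvent ends u o) = 0 := by linarith
    have h2 : prob p (TEvent ends u a₂ c ∩ connEvent ends u o) = 0 := by linarith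
    rw [hsum2, h1, h2]
    simp
  · -- `W > 0`: `0 ≤ W · (YA)` and divide
    refine le_of_mul_le_mul_left ?_ hWpos
    rw [mul_zero]
    linear_combination g1 + g2 + g3 + g4

end YA

end RootLeafU

end Summit.Ventures.PercRepro2
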